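import Literature.AlgebraicGeometry.Resolution.AlterationsStrong
import Mathlib.AlgebraicGeometry.Morphisms.QuasiCompact
import Mathlib.AlgebraicGeometry.Morphisms.FiniteType
import Mathlib.Topology.KrullDimension
import HarnessLib

/-!
# Maximal bad points (crux `FInjectiveMacaulayfication`, hole #3: the H3 ↔ H10 bridge)

[OURS · L1 W4.5a] Support file for crux stmt-ResolutionOfSingularities-15315
(`Summit.ResolutionOfSingularities.ResolutionOfSingularities.Theses.FrobeniusLadder.FInjectiveMacaulayfication`,
route `FrobeniusLadder`, registered skeleton v11 `86e9127b5c98b8e6`), hole #3 = registered stub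
`stub_genericFInjectivization`.  The measure-descent spine H3 (`MeasureDescent.genericFInjectivization_of_measure`,
landed) hands a card an admissible `X/k` with SOME non-closed point at which the Frobenius clause fails; the
planner's step shape H10 `ConfinedIsoStep` (CRUX-PLAN v3 §E / §R2(a)(a1)) starts from a non-closed bad point
`η` which is MAXIMAL — every proper generization of `η` is good.  This file is the bridge: on a scheme
quasi-compact and locally of finite type over a field (finite dimensional), for ANY predicate `Q` on points, a
non-closed point failing `Q` can be traded for a non-closed point failing `Q` all of whose proper generizations
satisfy `Q`.

* §1 `exists_mem_forall_specializes_notMem` — topology: in a `T₀` space of finite topological Krull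
  dimension every non-empty set `S` of points has a member `η` none of whose proper generizations lies in `S`
  (heights of the irreducible closed sets `closure {x}` are bounded, and strictly increase under proper
  generization: Mathlib `Order.height_strictMono`, `Order.height_le_krullDim`);
  `not_isClosed_singleton_of_specializes` — a proper generization of any point is a non-closed point.
* §2 `exists_maximal_not_of_exists_not_isClosed` — schemes: for `f : X ⟶ Spec k` quasi-compact and locally
  of finite type (`topologicalKrullDim X < ∞`: `Literature…exists_topologicalKrullDim_le_of_locallyOfFiniteType`)
  and any `Q : X → Prop`, `(∃ x, ¬ IsClosed {x} ∧ ¬ Q x) → ∃ η, ¬ IsClosed {η} ∧ ¬ Q η ∧ ∀ y ⤳ η, y ≠ η → Q y`;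
  `exists_maximal_of_exists` — the same without the non-closedness bookkeeping (any bad point ⇒ a
  generization-maximal bad point).

Folklore (finite-dimensional Noetherian induction on the generic points of the bad locus); no definition is
declared; the file does not import the route file.  AI-written; weaker than expert review; no statement of
[claim: Hironaka2017] is used.
-/

-- single-problem summit: the doubled namespace component `ResolutionOfSingularities` is forced
set_option linter.dupNamespace false

noncomputable section

namespace Summit.ResolutionOfSingularities.ResolutionOfSingularities.Theorems.FInjectiveMacaulayfication.MaximalBadPoint

open CategoryTheory AlgebraicGeometry TopologicalSpace
open Literature.AlgebraicGeometry.Resolution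

universe v

/-! ## §1 Topology: generization-maximal members of a set of points -/

/-- A proper generization `y ⤳ x`, `y ≠ x`, is never a closed point (its closure contains `x`). [folklore] -/
theorem not_isClosed_singleton_of_specializes {X : Type v} [TopologicalSpace X] {x y : X} (h : y ⤳ x)
    (hne : y ≠ x) : ¬ IsClosed ({y} : Set X) := fun hc => by
  have hx : x ∈ closure ({y} : Set X) := specializes_iff_mem_closure.mp h
  rw [hc.closure_eq, Set.mem_singleton_iff] at hx
  exact hne hx.symm

/-- **Generization-maximal members exist in finite dimension.** In a `T₀` space `X` of finite topological
Krull dimension, every non-empty set `S ⊆ X` has a member `η` such that no proper generization of `η` lies in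
`S`: the irreducible closed sets `closure {x}` have heights bounded by `dim X`, and `y ⤳ η`, `y ≠ η` forces
`closure {η} ⊊ closure {y}` (by `T₀`), so the height strictly increases (`Order.height_strictMono`); minimise
`dim X − height`. [folklore] -/
theorem exists_mem_forall_specializes_notMem {X : Type v} [TopologicalSpace X] [T0Space X]
    (hX : ∃ d : ℕ, topologicalKrullDim X ≤ d) {S : Set X} (hS : S.Nonempty) :
    ∃ η ∈ S, ∀ y : X, y ⤳ η → y ≠ η → y ∉ S := by
  obtain ⟨d, hd⟩ := hX
  -- the irreducible closed set `closure {x}` of a point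
  let c : X → IrreducibleCloseds X := fun x =>
    ⟨closure ({x} : Set X), isIrreducible_singleton.closure, isClosed_closure⟩
  -- heights are bounded by `d`, hence finite
  have hle : ∀ x : X, Order.height (c x) ≤ (d : ℕ∞) := fun x => by
    have h1 : ((Order.height (c x) : ℕ∞) : WithBot ℕ∞) ≤ (d : WithBot ℕ∞) :=
      (Order.height_le_krullDim (c x)).trans hd
    exact_mod_cast h1
  have hfin : ∀ x : X, Order.height (c x) < ⊤ := fun x =>
    lt_of_le_of_lt (hle x) (ENat.coe_lt_top d)
  -- a proper generization strictly increases the height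
  have hlt : ∀ {x y : X}, y ⤳ x → y ≠ x → Order.height (c x) < Order.height (c y) := by
    intro x y hyx hne
    refine Order.height_strictMono (lt_of_le_of_ne ?_ ?_) (hfin x)
    · change closure ({x} : Set X) ⊆ closure {y}
      exact specializes_iff_closure_subset.mp hyx
    · intro hxy
      have hcl : closure ({x} : Set X) = closure {y} := congrArg (fun s : IrreducibleCloseds X => (s : Set X)) hxy
      exact hne (inseparable_iff_closure_eq.mpr hcl).eq.symm
  -- integer heights and the measure `d - height`
  let t : X → ℕ := fun x => (Order.height (c x)).toNat
  have ht : ∀ x : X, (t x : ℕ∞) = Order.height (c x) := fun x => ENat.coe_toNat (hfin x).ne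
  obtain ⟨η, hηS, hmin⟩ := (measure fun x : X => d - t x).wf.has_min S hS
  refine ⟨η, hηS, fun y hy hne hyS => hmin y hyS ?_⟩
  have h1 : t η < t y := by
    have := hlt hy hne
    rw [← ht η, ← ht y] at this
    exact_mod_cast this
  have h2 : t y ≤ d := by
    have := hle y
    rw [← ht y] at this
    exact_mod_cast this
  change d - t y < d - t η
  omega

/-! ## §2 Schemes of finite type over a field: maximal bad points -/

/-- **Maximal non-closed bad points exist** (the H3 ↔ H10 bridge).  Let `f : X ⟶ Spec k` be quasi-compact
and locally of finite type and `Q` any predicate on the points of `X`.  If `Q` fails at some non-closed point,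
then it fails at some non-closed point `η` all of whose proper generizations `y ⤳ η`, `y ≠ η` satisfy `Q`
(`X` is `T₀` of finite dimension, `Literature…exists_topologicalKrullDim_le_of_locallyOfFiniteType`; apply §1 to
the set of non-closed points failing `Q` — a proper generization of `η` is again non-closed, so it must satisfy
`Q`). [folklore] -/
theorem exists_maximal_not_of_exists_not_isClosed {k : Type} [Field k] {X : Scheme.{0}}
    (f : X ⟶ Spec (.of k)) [LocallyOfFiniteType f] [QuasiCompact f] (Q : X → Prop)
    (h : ∃ x : X, ¬ IsClosed ({x} : Set X) ∧ ¬ Q x) :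
    ∃ η : X, ¬ IsClosed ({η} : Set X) ∧ ¬ Q η ∧ ∀ y : X, y ⤳ η → y ≠ η → Q y := by
  haveI : CompactSpace X :=
    (HasAffineProperty.iff_of_isAffine (P := @QuasiCompact)).mp ‹QuasiCompact f›
  have hX : ∃ d : ℕ, topologicalKrullDim X ≤ d := exists_topologicalKrullDim_le_of_locallyOfFiniteType f
  obtain ⟨x, hx, hQ⟩ := h
  obtain ⟨η, ⟨hη, hQη⟩, hmax⟩ := exists_mem_forall_specializes_notMem hX
    (S := {x : X | ¬ IsClosed ({x} : Set X) ∧ ¬ Q x}) ⟨x, hx, hQ⟩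
  refine ⟨η, hη, hQη, fun y hy hne => ?_⟩
  by_contra hQy
  exact hmax y hy hne ⟨not_isClosed_singleton_of_specializes hy hne, hQy⟩

/-- **Maximal bad points exist** (no closedness bookkeeping): for `f : X ⟶ Spec k` quasi-compact and locally
of finite type and any `Q : X → Prop` failing somewhere, `Q` fails at some point `η` all of whose proper
generizations satisfy `Q`. [folklore] -/
theorem exists_maximal_of_exists {k : Type} [Field k] {X : Scheme.{0}} (f : X ⟶ Spec (.of k))
    [LocallyOfFiniteType f] [QuasiCompact f] (Q : X → Prop) (h : ∃ x : X, ¬ Q x) :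
    ∃ η : X, ¬ Q η ∧ ∀ y : X, y ⤳ η → y ≠ η → Q y := by
  haveI : CompactSpace X :=
    (HasAffineProperty.iff_of_isAffine (P := @QuasiCompact)).mp ‹QuasiCompact f›
  have hX : ∃ d : ℕ, topologicalKrullDim X ≤ d := exists_topologicalKrullDim_le_of_locallyOfFiniteType f
  obtain ⟨x, hQ⟩ := h
  obtain ⟨η, hQη, hmax⟩ := exists_mem_forall_specializes_notMem hX (S := {x : X | ¬ Q x}) ⟨x, hQ⟩
  exact ⟨η, hQη, fun y hy hne => by_contra fun hQy => hmax y hy hne hQy⟩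

end Summit.ResolutionOfSingularities.ResolutionOfSingularities.Theorems.FInjectiveMacaulayfication.MaximalBadPoint

end
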